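import Summits.ResolutionOfSingularities.ResolutionOfSingularities.Theorems.PurelyInseparableDim4ResConePowerChain
import Summits.ResolutionOfSingularities.ResolutionOfSingularities.Theorems.PurelyInseparableDim4ResConeShearTransport
import Summits.ResolutionOfSingularities.ResolutionOfSingularities.Theorems.PurelyInseparableDim4ResConeTwoSlotFlag
import Summits.ResolutionOfSingularities.ResolutionOfSingularities.Theorems.PurelyInseparableDim4Directrix
import HarnessLib

/-!
# Purely inseparable four-folds — NO FREE-LETTER CHART on the C∞ tail: the steps are λ/μ-corners
# (K24b-FRAME, file F2b «steps are pure λ/μ-corners in the frame»: cell `res-dim4-pi`, K2(p) lane, slice B)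

[OURS · counted 0 · cell `res-dim4-pi` · K2(p) lane holder res-dim4-p-12 g3's split of K24b by file (bus
2026-08-29 02:23:39Z; owners 03:02:06Z: F2 = res-dim4-p-2 g4); power-cone package res-dim4-p-9 g2/g3
(`…ResConePowerChain`); one-letter shear step res-dim4-p-5 g3 (`…ResConeShearTransport`); (VT-f) in the chart `λ`
res-dim4-typ-1 g2 (`…ResConeCInfPinning`), (VT-u) res-dim4-p-2 g4 (`…ResConeCInfPinningU`).]  Nothing here proves
K2(p)/K2(5), `NoIsolatedTrap 5 5` or resolution of singularities in dimension ≥ 4 / characteristic `p` — NOT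
proved.  AI kernel work, weaker than expert review.

On a shade-`4` power-cone stretch the package `chain_powerCone_package` gives at every stage the identity
`ℓ_{j} + ℓ ⬝ᵥ b = 0` (the chart coefficient of the vertex form is dictated by the chart point).  For a STRAIGHT form
`ℓ = ℓ_f e_f` this reads (§1): the chart letter is never the contact letter `f` (`chart_ne_contact_of_straight`) and
`f` is never translated, in ANY chart (`translation_contact_eq_zero_of_straight` — typ-1's (VT-f) without the
`x_λ x_μ`-coefficient).  §3 **`cInf_no_free_chart`** excludes the chart of the FREE letter `u` with one ledger letter
`α` dropped (`b_α ≠ 0`; at `p = 5`, ledger `x_α x_β`): the child has order `6` and boundary `x_β x_u`, its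
degree-`5` coefficient at `x_α x_β² x_u²` vanishes and reads `2tV + 4t³c₄ + 5t⁴c₅` (`t = b_α`, `V` the `u`-axis flag,
the pair-ledger entry `x_α x_β² u⁴` and the dead `ū²`-row entry `x_α³ x_β² u²` being `0`), its degree-`6` coefficient
at `x_α² x_β² x_u²` reads `V + 6t²c₄ + 10t³c₅` and vanishes because the child's initial form `x_β x_u·a′(ℓ′)⁴` has no
`x_α` (`ℓ′_α = λ′ℓ_α = 0`, §2 `coeff_linearFormSum_pow_eq_zero_of_apply`); in characteristic `5` this forces
`V = 0`.  This is the chart-`u` twin of (VT-u): the point `(b_λ : 0 : 1 : 0) = (1 : 0 : 1/b_λ : 0)` of the exceptional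
divisor.  Headline **`cInf_chart_eq_or_eq`**: with `|r_{k+1}| = 2` (weights, res-dim4-p-2 g4's K28a) the chart letter
is a LEDGER letter, `j_k = α ∨ j_k = β` — together with (VT-f)/(VT-u) (zero translation in the charts `λ, μ`) the
steps of the C∞ tail are pure `λ/μ`-corners, which is what the game step (`…ResConeCInfGameStep`) transports.
bears_on: LADDER-RESOLUTION:D157-DOOR2 (res-dim4-pi · K2(p) · slice B · K24b-FRAME F2b).  Supports
stmt-ResolutionOfSingularities-16155 (helper).
-/

set_option linter.dupNamespace false -- mandated namespace of this single-conjunct summit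

namespace Summit.ResolutionOfSingularities.ResolutionOfSingularities.Theorems.PIDim4

namespace ResCone

open MvPolynomial Finset
open Literature.AlgebraicGeometry.Resolution
open Literature.AlgebraicGeometry.Resolution.CentreBlowup
open Literature.AlgebraicGeometry.Resolution.Hauser2010
open Literature.AlgebraicGeometry.Resolution.HauserPerlega2019

variable {K : Type} [Field K]

/-! ## 1. The chart coefficient of a straight vertex form -/

section Straight

/-- For a STRAIGHT form `ℓ = ℓ_f e_f` the package identity `ℓ_j + ℓ ⬝ᵥ b = 0` (the chart coefficient is dictated
by the chart point) reads `ℓ_j + ℓ_f b_f = 0`. [OURS · bookkeeping] -/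
theorem chart_identity_of_straight {ℓ b : Fin 4 → K} {j f : Fin 4} (hstraight : ∀ i, i ≠ f → ℓ i = 0)
    (hchart : ℓ j + dotProduct ℓ b = 0) : ℓ j + ℓ f * b f = 0 := by
  have hdot : dotProduct ℓ b = ℓ f * b f := by
    unfold dotProduct
    rw [Finset.sum_eq_single f]
    · intro i _ hif; rw [hstraight i hif, zero_mul]
    · intro h; exact absurd (Finset.mem_univ f) h
  rw [hdot] at hchart
  exact hchart

/-- **No contact chart**: on the power-cone stretch a step is never taken in the chart of the contact letter
`f` of a straight vertex form (`ℓ_f + ℓ_f · b_f = ℓ_f ≠ 0`, as `b_f = 0` in the chart of `f`). [OURS] -/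
theorem chart_ne_contact_of_straight {ℓ b : Fin 4 → K} {j f : Fin 4} (hℓ : ℓ ≠ 0)
    (hstraight : ∀ i, i ≠ f → ℓ i = 0) (hbj : b j = 0) (hchart : ℓ j + dotProduct ℓ b = 0) : j ≠ f := by
  intro hjf
  subst hjf
  have h := chart_identity_of_straight hstraight hchart
  rw [hbj, mul_zero, add_zero] at h
  apply hℓ
  funext i
  by_cases hi : i = j
  · rw [hi]; exact h
  · exact hstraight i hi

/-- **The contact letter is never translated** (in ANY chart other than `f`): `ℓ_j = 0` for `j ≠ f`, so
`ℓ_f b_f = 0` and `b_f = 0` — res-dim4-typ-1 g2's (VT-f) `cInf_translation_contact_eq_zero` is the chart-`λ` case,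
read here off the power-cone package instead of the `x_λ x_μ`-coefficient. [OURS] -/
theorem translation_contact_eq_zero_of_straight {ℓ b : Fin 4 → K} {j f : Fin 4} (hℓ : ℓ ≠ 0)
    (hstraight : ∀ i, i ≠ f → ℓ i = 0) (hjf : j ≠ f) (hchart : ℓ j + dotProduct ℓ b = 0) : b f = 0 := by
  have h := chart_identity_of_straight hstraight hchart
  rw [hstraight j hjf, zero_add] at h
  have hℓf : ℓ f ≠ 0 := by
    intro h0
    apply hℓ
    funext i
    by_cases hi : i = f
    · rw [hi]; exact h0
    · exact hstraight i hi
  rcases mul_eq_zero.mp h with h1 | h1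
  · exact absurd h1 hℓf
  · exact h1

end Straight

/-! ## 2. A linear form without `x_a` has powers without `x_a` -/

section NoLetter

/-- If `ℓ_a = 0` then no monomial of `(Σ ℓ_i x_i)^n` involves `x_a`. [folklore] -/
theorem coeff_linearFormSum_pow_eq_zero_of_apply {ℓ : Fin 4 → K} {a : Fin 4} (ha : ℓ a = 0) (n : ℕ)
    {m : Fin 4 →₀ ℕ} (hm : m a ≠ 0) : coeff m ((∑ i, C (ℓ i) * X i : MvPolynomial (Fin 4) K) ^ n) = 0 := by
  classical
  have hvars : a ∉ ((∑ i, C (ℓ i) * X i : MvPolynomial (Fin 4) K) ^ n).vars := by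
    intro hmem
    have h1 := vars_pow _ n hmem
    obtain ⟨i, -, hi⟩ := Finset.mem_biUnion.mp (vars_sum_subset _ _ h1)
    by_cases hia : i = a
    · subst hia
      rw [ha, C_0, zero_mul, vars_0] at hi
      exact Finset.notMem_empty _ hi
    · have h2 := vars_mul _ _ hi
      rw [Finset.mem_union] at h2
      rcases h2 with h2 | h2
      · rw [vars_C] at h2; exact Finset.notMem_empty _ h2
      · rw [vars_X, Finset.mem_singleton] at h2; exact hia h2.symm
  by_contra hc
  apply hvars
  rw [mem_vars_iff_mem_support]
  exact ⟨m, mem_support_iff.mpr hc, Finsupp.mem_support_iff.mpr hm⟩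

end NoLetter

/-! ## 3. No free-letter chart on the C∞ tail -/

section Chain

variable [CharP K 5] [DecidableEq K]

/-- **NO FREE-LETTER CHART** (K24b-FRAME F2b; the chart-`u` twin of (VT-u), same geometric point
`(1 : 0 : b_u : 0) = (b_λ : 0 : 1 : 0)` of the exceptional divisor): on a shade-`4` power-cone stretch at `p = 5`,
with ledger `r_k = x_α x_β`, a step in the chart of the FREE letter `u` that drops the ledger letter `α`
(`b_k α ≠ 0`; `β` kept, `f` untranslated) is impossible, given the frame readings at stage `k` — the pair-ledger
entry `coeff (α + 2β + 4u) F_k = 0`, the `u`-axis flag `V = coeff (2α + 2β + 3u) F_k ≠ 0`, the dead `ū²`-row entry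
`coeff (3α + 2β + 2u) F_k = 0` — and a vertex form at stage `k` without `x_α` (straight), the stage-`k+1` form being
the package's (`ℓ′ = λ′ ℓ` off the chart letter).  Proof: the child has order `6` and boundary `x_β x_u`; its
coefficient at `x_α x_β² x_u²` (degree `5`) vanishes and reads `2tV + 4t³c₄ + 5t⁴c₅` (`t = b_k α`, p-5's
`coeff_step_single_chartExponent`); its coefficient at `x_α² x_β² x_u²` reads `V + 6t²c₄ + 10t³c₅` and vanishes
because the child's initial form `x_β x_u · a′(ℓ′)⁴` has no `x_α` (`ℓ′_α = λ′ ℓ_α = 0`); in characteristic `5`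
these force `c₄ = 0` and `V = 0`. [OURS] [cite: CossartJannsenSaito2020, Thm. 3.10(4), Thm. 9.3] -/
theorem cInf_no_free_chart {c : ℕ → State K} {j : ℕ → Fin 4} {b : ℕ → Fin 4 → K}
    (hc : ∀ k, IsIsolated 5 (c k).F ∧ Step0 5 (c k) (c (k + 1))) (hw : FreeTail.IsWitnessedChain 5 c j b)
    (hr0 : ∀ e ∈ (c 0).F.support, (c 0).r ≤ e) (hfloor : ∀ k, ordZero (c k).F ≠ (5 : ℕ)) {k₀ : ℕ}
    (hshade : ∀ k, k₀ ≤ k → (c k).shade = ((4 : ℕ) : ℕ∞)) {k : ℕ} (hk : k₀ ≤ k)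
    {ℓ ℓ' : Fin 4 → K} {a₀' lam' : K} (hform' : resForm (c (k + 1)) = C a₀' * (∑ i, C (ℓ' i) * X i) ^ 4)
    (hlam : ∀ i, i ≠ j k → ℓ' i = lam' * ℓ i) {al be u f : Fin 4} (hab : al ≠ be) (hau : al ≠ u)
    (haf : al ≠ f) (hbu : be ≠ u) (hbf : be ≠ f) (huf : u ≠ f) (hju : j k = u) (hℓa : ℓ al = 0)
    (hr : (c k).r = Finsupp.single al 1 + Finsupp.single be 1) (hbb : b k be = 0) (hbf0 : b k f = 0)
    (hba : b k al ≠ 0)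
    (hled : coeff (Finsupp.single al 1 + Finsupp.single be 2 + Finsupp.single u 4) (c k).F = 0)
    (hV : coeff (Finsupp.single al 2 + Finsupp.single be 2 + Finsupp.single u 3) (c k).F ≠ 0)
    (hdead : coeff (Finsupp.single al 3 + Finsupp.single be 2 + Finsupp.single u 2) (c k).F = 0) : False := by
  haveI : Fact (Nat.Prime 5) := ⟨by norm_num⟩
  subst hju
  -- three-letter exponents as four-letter ones
  have hz : ∀ x y z : ℕ, (Finsupp.single al x + Finsupp.single be y + Finsupp.single (j k) z : Fin 4 →₀ ℕ) =
      Finsupp.single al x + Finsupp.single be y + Finsupp.single (j k) z + Finsupp.single f 0 := by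
    intro x y z; rw [Finsupp.single_zero, add_zero]
  rw [hz] at hled hV hdead
  -- band data at stage `k`
  obtain ⟨o, ho, -, -, hod⟩ := chain_shade_nat 5 hc hfloor hshade hk
  have hrdeg : (c k).r.degree = 2 := by rw [hr, map_add, Finsupp.degree_single, Finsupp.degree_single]
  have ho6 : o = 6 := by omega
  subst ho6
  have hq : ((5 : ℕ) : ℕ∞) ≤ ordAlong Finset.univ (c k).F := (hw k).1
  have hbj : b k (j k) = 0 := (hw k).2.1
  have hstep : c (k + 1) = CentreBlowup.step 5 Finset.univ (j k) (b k) (c k) := (hw k).2.2.2.2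
  -- the translation vector is `t · e_α`
  have hbs : b k = Pi.single al (b k al) := by
    funext i
    rcases letters_exhaust hab hau haf hbu hbf huf i with h | h | h | h <;> rw [h]
    · rw [Pi.single_eq_same]
    · rw [Pi.single_eq_of_ne hab.symm, hbb]
    · rw [Pi.single_eq_of_ne hau.symm, hbj]
    · rw [Pi.single_eq_of_ne haf.symm, hbf0]
  -- boundary and order at stage `k + 1`
  have hdivk := IsolatedBand.isolated_chain_forall_le hc hr0 k
  have hdivk1 := IsolatedBand.isolated_chain_forall_le hc hr0 (k + 1)
  have hr' : (c (k + 1)).r = Finsupp.single be 1 + Finsupp.single (j k) 1 := by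
    rw [hstep, step_r_univ 5 (j k) hbj (c k) ho hdivk, hr]
    ext i
    rw [Finsupp.update_apply, Finsupp.filter_apply, Finsupp.add_apply, Finsupp.add_apply]
    rcases letters_exhaust hab hau haf hbu hbf huf i with h | h | h | h <;> rw [h]
    · rw [if_neg hau, if_neg hba, Finsupp.single_eq_of_ne hab, Finsupp.single_eq_of_ne hau]
      omega
    · rw [if_neg hbu, if_pos hbb, Finsupp.single_eq_of_ne hab.symm, Finsupp.single_eq_same,
        Finsupp.single_eq_of_ne hbu]
      omega
    · rw [if_pos rfl, Finsupp.single_eq_of_ne hbu.symm, Finsupp.single_eq_same]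
    · rw [if_neg huf.symm, if_pos hbf0, Finsupp.single_eq_of_ne haf.symm, Finsupp.single_eq_of_ne hbf.symm,
        Finsupp.single_eq_of_ne huf.symm]
  obtain ⟨o', ho', -, -, hod'⟩ := chain_shade_nat 5 hc hfloor hshade (k := k + 1) (by omega)
  have hr'deg : (c (k + 1)).r.degree = 2 := by rw [hr', map_add, Finsupp.degree_single, Finsupp.degree_single]
  have ho'6 : o' = 6 := by omega
  subst ho'6
  -- the update bookkeeping of `coeff_step_single_chartExponent`
  have hupd : ∀ (n₁ n₂ n₃ x y : ℕ),
      ((Finsupp.single al n₁ + Finsupp.single be n₂ + Finsupp.single (j k) n₃ + Finsupp.single f 0 :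
          Fin 4 →₀ ℕ).update (j k) x).update al y =
        Finsupp.single al y + Finsupp.single be n₂ + Finsupp.single (j k) x + Finsupp.single f 0 := by
    intro n₁ n₂ n₃ x y
    obtain ⟨h1, h2, h3, h4⟩ := quad_apply hab hau haf hbu hbf huf n₁ n₂ n₃ 0
    obtain ⟨h1', h2', h3', h4'⟩ := quad_apply hab hau haf hbu hbf huf y n₂ x 0
    ext i
    simp only [Finsupp.coe_update]
    rcases letters_exhaust hab hau haf hbu hbf huf i with h | h | h | h <;> rw [h]
    · rw [Function.update_self, h1']
    · rw [Function.update_of_ne hab.symm, Function.update_of_ne hbu, h2', h2]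
    · rw [Function.update_of_ne hau.symm, Function.update_self, h3']
    · rw [Function.update_of_ne haf.symm, Function.update_of_ne huf.symm, h4', h4]
  have hce : ∀ (n₁ n₂ n₃ : ℕ), 5 ≤ n₁ + n₂ + n₃ →
      chartExponent 5 Finset.univ (j k)
          (Finsupp.single al n₁ + Finsupp.single be n₂ + Finsupp.single (j k) n₃ + Finsupp.single f 0) =
        Finsupp.single al n₁ + Finsupp.single be n₂ + Finsupp.single (j k) (n₁ + n₂ + n₃ - 5) +
          Finsupp.single f 0 := by
    intro n₁ n₂ n₃ hn
    obtain ⟨h1, h2, h3, h4⟩ := quad_apply hab hau haf hbu hbf huf n₁ n₂ n₃ 0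
    obtain ⟨h1', h2', h3', h4'⟩ := quad_apply hab hau haf hbu hbf huf n₁ n₂ (n₁ + n₂ + n₃ - 5) 0
    ext i
    rcases letters_exhaust hab hau haf hbu hbf huf i with h | h | h | h <;> rw [h]
    · rw [chartExponent_apply_of_ne 5 Finset.univ hau, h1, h1']
    · rw [chartExponent_apply_of_ne 5 Finset.univ hbu, h2, h2']
    · rw [chartExponent_univ_apply_self, degree_quad, h3']; omega
    · rw [chartExponent_apply_of_ne 5 Finset.univ huf.symm, h4, h4']
  -- (E2): the degree-5 coefficient `x_α x_β² x_u²` of the child vanishes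
  have h2 := coeff_step_single_chartExponent 5 hau.symm (b k al) (c k) hq
    (e := Finsupp.single al 1 + Finsupp.single be 2 + Finsupp.single (j k) 4 + Finsupp.single f 0)
    (by rw [degree_quad]; norm_num)
  obtain ⟨h21, -, h23, -⟩ := quad_apply hab hau haf hbu hbf huf 1 2 4 0
  have hT₂ : coeff (Finsupp.single al 1 + Finsupp.single be 2 + Finsupp.single (j k) 2 + Finsupp.single f 0)
      (c (k + 1)).F = 0 :=
    coeff_eq_zero_of_degree_lt_ordZero (by rw [ho', degree_quad]; exact_mod_cast (by norm_num : 1 + 2 + 2 + 0 < 6))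
  rw [← hbs, ← hstep, hce 1 2 4 (by norm_num), show 1 + 2 + 4 - 5 = 2 from rfl, hT₂, if_neg
    (not_isPthPowerExponent_of_not_dvd (i := al)
      (by rw [(quad_apply hab hau haf hbu hbf huf 1 2 2 0).1]; decide)), h21, h23] at h2
  rw [Finset.sum_range_succ, Finset.sum_range_succ, Finset.sum_range_succ, Finset.sum_range_succ,
    Finset.sum_range_succ, Finset.sum_range_zero, zero_add, hupd, hupd, hupd, hupd, hupd] at h2
  rw [show 4 - 0 = 4 from rfl, show 1 + 0 = 1 from rfl, show 4 - 1 = 3 from rfl, show 1 + 1 = 2 from rfl,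
    show 4 - 2 = 2 from rfl, show 1 + 2 = 3 from rfl, show 4 - 3 = 1 from rfl, show 1 + 3 = 4 from rfl,
    show 4 - 4 = 0 from rfl, show 1 + 4 = 5 from rfl, hled, hdead] at h2
  -- (E3): the degree-6 coefficient `x_α² x_β² x_u²` of the child
  have h3 := coeff_step_single_chartExponent 5 hau.symm (b k al) (c k) hq
    (e := Finsupp.single al 2 + Finsupp.single be 2 + Finsupp.single (j k) 3 + Finsupp.single f 0)
    (by rw [degree_quad]; norm_num)
  obtain ⟨h31, -, h33, -⟩ := quad_apply hab hau haf hbu hbf huf 2 2 3 0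
  rw [← hbs, ← hstep, hce 2 2 3 (by norm_num), show 2 + 2 + 3 - 5 = 2 from rfl, if_neg
    (not_isPthPowerExponent_of_not_dvd (i := al)
      (by rw [(quad_apply hab hau haf hbu hbf huf 2 2 2 0).1]; decide)), h31, h33] at h3
  rw [Finset.sum_range_succ, Finset.sum_range_succ, Finset.sum_range_succ, Finset.sum_range_succ,
    Finset.sum_range_zero, zero_add, hupd, hupd, hupd, hupd] at h3
  rw [show 3 - 0 = 3 from rfl, show 2 + 0 = 2 from rfl, show 3 - 1 = 2 from rfl, show 2 + 1 = 3 from rfl,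
    show 3 - 2 = 1 from rfl, show 2 + 2 = 4 from rfl, show 3 - 3 = 0 from rfl, show 2 + 3 = 5 from rfl,
    hdead] at h3
  -- the same coefficient vanishes: the child's initial form `x_β x_u · a′ (ℓ′)⁴` has no `x_α`
  have hℓ'a : ℓ' al = 0 := by rw [hlam al hau, hℓa, mul_zero]
  have hT₃eq : (Finsupp.single al 2 + Finsupp.single be 2 + Finsupp.single (j k) 2 + Finsupp.single f 0 :
      Fin 4 →₀ ℕ) = (c (k + 1)).r +
        (Finsupp.single al 2 + Finsupp.single be 1 + Finsupp.single (j k) 1 + Finsupp.single f 0) := by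
    rw [hr', show (Finsupp.single be 2 : Fin 4 →₀ ℕ) = Finsupp.single be 1 + Finsupp.single be 1 by
      rw [← Finsupp.single_add], show (Finsupp.single (j k) 2 : Fin 4 →₀ ℕ) =
      Finsupp.single (j k) 1 + Finsupp.single (j k) 1 by rw [← Finsupp.single_add]]
    abel
  have hT₃ : coeff (Finsupp.single al 2 + Finsupp.single be 2 + Finsupp.single (j k) 2 + Finsupp.single f 0)
      (c (k + 1)).F = 0 := by
    rw [← NarrowApolarity.coeff_initialForm_of_degree_eq ho' (by rw [degree_quad]), hT₃eq,
      ← monomial_mul_resForm hdivk1, coeff_monomial_mul, one_mul, hform', coeff_C_mul,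
      coeff_linearFormSum_pow_eq_zero_of_apply hℓ'a 4
        (by rw [(quad_apply hab hau haf hbu hbf huf 2 1 1 0).1]; decide), mul_zero]
  rw [hT₃, show Nat.choose 2 0 = 1 by decide, show Nat.choose 3 1 = 3 by decide, show Nat.choose 4 2 = 6 by decide,
    show Nat.choose 5 3 = 10 by decide] at h3
  rw [show Nat.choose 1 0 = 1 by decide, show Nat.choose 2 1 = 2 by decide, show Nat.choose 3 2 = 3 by decide,
    show Nat.choose 4 3 = 4 by decide, show Nat.choose 5 4 = 5 by decide] at h2
  push_cast at h2 h3
  -- the arithmetic in characteristic `5`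
  set t := b k al with ht
  set V := coeff (Finsupp.single al 2 + Finsupp.single be 2 + Finsupp.single (j k) 3 + Finsupp.single f 0)
    (c k).F with hVdef
  set c₄ := coeff (Finsupp.single al 4 + Finsupp.single be 2 + Finsupp.single (j k) 1 + Finsupp.single f 0)
    (c k).F with hc₄def
  set c₅ := coeff (Finsupp.single al 5 + Finsupp.single be 2 + Finsupp.single (j k) 0 + Finsupp.single f 0)
    (c k).F with hc₅def
  have h5 : (5 : K) = 0 := by
    have h := CharP.cast_eq_zero K 5
    exact_mod_cast h
  have h3ne : (3 : K) ≠ 0 := by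
    intro h
    have h' : ((3 : ℕ) : K) = 0 := by exact_mod_cast h
    rw [CharP.cast_eq_zero_iff K 5] at h'
    omega
  have key : (3 : K) * (t ^ 3 * c₄) = 0 := by
    linear_combination h2 + (-2 * t) * h3 + (-(t ^ 3 * c₄) - 3 * t ^ 4 * c₅) * h5
  have hc4 : c₄ = 0 := by
    rcases mul_eq_zero.mp key with h | h
    · exact absurd h h3ne
    · rcases mul_eq_zero.mp h with h' | h'
      · exact absurd h' (pow_ne_zero 3 hba)
      · exact h'
  have hV0 : V = 0 := by
    linear_combination (-1 : K) * h3 - 6 * t ^ 2 * hc4 - 2 * t ^ 3 * c₅ * h5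
  exact hV hV0

/-- **STEPS ARE λ/μ-CORNERS — the chart letter** (K24b-FRAME F2b, headline): on a shade-`4` power-cone stretch at
`p = 5` whose stage-`k` vertex form `ℓ` is STRAIGHT (`ℓ = ℓ_f e_f`) with package identity
`ℓ_{j_k} + ℓ ⬝ᵥ b_k = 0`, ledger `r_k = x_α x_β` and `|r_{k+1}| = 2`, and with the frame readings at stage `k`
(`u`-axis flag `V ≠ 0`, the two pair-ledger entries `x_α x_β² u⁴`, `x_α² x_β u⁴` and the two dead-`ū²`-row entries
`x_α³x_β²u²`, `x_α²x_β³u²` absent), the chart letter is a LEDGER letter: `j_k = α ∨ j_k = β`.  (Chart `f`: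
`chart_ne_contact_of_straight`; chart `u`: both ledger letters kept gives `|r′| = 3`, both dropped `|r′| = 1`, one
dropped is `cInf_no_free_chart` or its mirror.) [OURS] [cite: CossartJannsenSaito2020, Thm. 3.10(4), Thm. 9.3] -/
theorem cInf_chart_eq_or_eq {c : ℕ → State K} {j : ℕ → Fin 4} {b : ℕ → Fin 4 → K}
    (hc : ∀ k, IsIsolated 5 (c k).F ∧ Step0 5 (c k) (c (k + 1))) (hw : FreeTail.IsWitnessedChain 5 c j b)
    (hr0 : ∀ e ∈ (c 0).F.support, (c 0).r ≤ e) (hfloor : ∀ k, ordZero (c k).F ≠ (5 : ℕ)) {k₀ : ℕ}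
    (hshade : ∀ k, k₀ ≤ k → (c k).shade = ((4 : ℕ) : ℕ∞)) {k : ℕ} (hk : k₀ ≤ k)
    {ℓ ℓ' : Fin 4 → K} {a₀' lam' : K} (hform' : resForm (c (k + 1)) = C a₀' * (∑ i, C (ℓ' i) * X i) ^ 4)
    (hlam : ∀ i, i ≠ j k → ℓ' i = lam' * ℓ i) (hℓ : ℓ ≠ 0) (hchart : ℓ (j k) + dotProduct ℓ (b k) = 0)
    {al be u f : Fin 4} (hab : al ≠ be) (hau : al ≠ u) (haf : al ≠ f) (hbu : be ≠ u) (hbf : be ≠ f)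
    (huf : u ≠ f) (hstraight : ∀ i, i ≠ f → ℓ i = 0) (hr : (c k).r = Finsupp.single al 1 + Finsupp.single be 1)
    (hw2 : (c (k + 1)).r.degree = 2)
    (hV : coeff (Finsupp.single al 2 + Finsupp.single be 2 + Finsupp.single u 3) (c k).F ≠ 0)
    (hledA : coeff (Finsupp.single al 1 + Finsupp.single be 2 + Finsupp.single u 4) (c k).F = 0)
    (hledB : coeff (Finsupp.single al 2 + Finsupp.single be 1 + Finsupp.single u 4) (c k).F = 0)
    (hdeadA : coeff (Finsupp.single al 3 + Finsupp.single be 2 + Finsupp.single u 2) (c k).F = 0)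
    (hdeadB : coeff (Finsupp.single al 2 + Finsupp.single be 3 + Finsupp.single u 2) (c k).F = 0) :
    j k = al ∨ j k = be := by
  haveI : Fact (Nat.Prime 5) := ⟨by norm_num⟩
  have hbj : b k (j k) = 0 := (hw k).2.1
  rcases letters_exhaust hab hau haf hbu hbf huf (j k) with h | h | h | h
  · exact Or.inl h
  · exact Or.inr h
  · exfalso
    -- chart `u`
    have hjf : j k ≠ f := by rw [h]; exact huf
    have hbf0 : b k f = 0 := translation_contact_eq_zero_of_straight hℓ hstraight hjf hchart
    -- the new boundary
    obtain ⟨o, ho, -, -, hod⟩ := chain_shade_nat 5 hc hfloor hshade hk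
    have hrdeg : (c k).r.degree = 2 := by rw [hr, map_add, Finsupp.degree_single, Finsupp.degree_single]
    have ho6 : o = 6 := by omega
    subst ho6
    have hdivk := IsolatedBand.isolated_chain_forall_le hc hr0 k
    have hr' : (c (k + 1)).r = ((Finsupp.single al 1 + Finsupp.single be 1 : Fin 4 →₀ ℕ).filter
        (fun i => b k i = 0)).update (j k) (6 - 5) := by
      rw [(hw k).2.2.2.2, step_r_univ 5 (j k) hbj (c k) ho hdivk, hr]
    by_cases hba : b k al = 0
    · by_cases hbb : b k be = 0
      · -- both ledger letters kept: `|r′| = 3`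
        have h3 : (c (k + 1)).r = Finsupp.single al 1 + Finsupp.single be 1 + Finsupp.single u 1 +
            Finsupp.single f 0 := by
          obtain ⟨h1, h2, h3, h4⟩ := quad_apply hab hau haf hbu hbf huf 1 1 1 0
          rw [hr', h]
          ext i
          rw [Finsupp.update_apply, Finsupp.filter_apply, Finsupp.add_apply]
          rcases letters_exhaust hab hau haf hbu hbf huf i with h' | h' | h' | h' <;> rw [h']
          · rw [if_neg hau, if_pos hba, Finsupp.single_eq_same, Finsupp.single_eq_of_ne hab, h1]
            omega
          · rw [if_neg hbu, if_pos hbb, Finsupp.single_eq_of_ne hab.symm, Finsupp.single_eq_same, h2]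
          · rw [if_pos rfl, h3]
          · rw [if_neg huf.symm, if_pos hbf0, Finsupp.single_eq_of_ne haf.symm, Finsupp.single_eq_of_ne hbf.symm,
              h4]
            omega
        rw [h3, degree_quad] at hw2
        omega
      · -- `β` dropped, `α` kept: the mirror of `cInf_no_free_chart`
        rw [add_comm (Finsupp.single al 2) (Finsupp.single be 2)] at hV
        rw [add_comm (Finsupp.single al 2) (Finsupp.single be 1)] at hledB
        rw [add_comm (Finsupp.single al 2) (Finsupp.single be 3)] at hdeadB
        exact cInf_no_free_chart hc hw hr0 hfloor hshade hk hform' hlam hab.symm hbu hbf hau haf huf h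
          (hstraight be hbf) (by rw [hr, add_comm]) hba hbf0 hbb hledB hV hdeadB
    · by_cases hbb : b k be = 0
      · -- `α` dropped, `β` kept
        exact cInf_no_free_chart hc hw hr0 hfloor hshade hk hform' hlam hab hau haf hbu hbf huf h
          (hstraight al haf) hr hbb hbf0 hba hledA hV hdeadA
      · -- both ledger letters dropped: `|r′| = 1`
        have h1 : (c (k + 1)).r = Finsupp.single al 0 + Finsupp.single be 0 + Finsupp.single u 1 +
            Finsupp.single f 0 := by
          obtain ⟨h1, h2, h3, h4⟩ := quad_apply hab hau haf hbu hbf huf 0 0 1 0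
          rw [hr', h]
          ext i
          rw [Finsupp.update_apply, Finsupp.filter_apply, Finsupp.add_apply]
          rcases letters_exhaust hab hau haf hbu hbf huf i with h' | h' | h' | h' <;> rw [h']
          · rw [if_neg hau, if_neg hba, h1]
          · rw [if_neg hbu, if_neg hbb, h2]
          · rw [if_pos rfl, h3]
          · rw [if_neg huf.symm, if_pos hbf0, Finsupp.single_eq_of_ne haf.symm, Finsupp.single_eq_of_ne hbf.symm,
              h4]
            omega
        rw [h1, degree_quad] at hw2
        omega
  · exact absurd h (chart_ne_contact_of_straight hℓ hstraight hbj hchart)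

end Chain

end ResCone

end Summit.ResolutionOfSingularities.ResolutionOfSingularities.Theorems.PIDim4
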